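import Summits.BirchSwinnertonDyer.Rank1Residual.Additive.KobayashiTowerPoints
import HarnessLib

/-!
# A finite subfield `F ⊂ Ω = ℚ̄_p` as a complete normed field TYPE, and the transport of points `E(F) → E(Ω)`
# (tool definitions for the plus-tower generation step of K4 `SignedControlAtTwo`, stmt-BirchSwinnertonDyer-20309, line `eulerchar` v6)

Route `ThetaPartnerAtTwo` (TP2), crux K4, lead seat `prover-bsd-wall-tp2-p3` (g2). TOOL DEFINITIONS (with bodies), no named fact, no `sorry`.

WHY. The O10 series' `PadicLayerTransport` packages the cyclotomic layer `layer p m = ℚ_p(ζ_{p^m}) ⊂ Ω` as the type synonym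
`LayerField p m` («carrying only the normed-field structure, so that its points use the classical decidable equality of the generic
theory» — the generic complete-field formal-group files `FormalGroupBallPoints`, `KobayashiLogFss`, … are stated for a field `K` with
the classical `DecidableEq`, and `↥F` itself would pick up `Subtype`'s instance). The plus tower `ℚ₂(ζ_{2^N} + ζ_{2^N}⁻¹)` at `p = 2`
(memo `Cruxes/SignedControlAtTwo/LAGPLUS-AT-2-CONSTRUCTION.md` §4) needs the same packaging for OTHER finite subfields of `Ω`; this file
does it once for an ARBITRARY intermediate field `F` (finite over `ℚ_p` where completeness is needed): the synonym `OmegaSubfield p F := ↥F`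
with its inherited instances, `emb`, `mk`, and `toOmega F : E(F-points) →+ E(Ω-points)` (Mathlib's `Affine.Point.map` of the inclusion).
Everything is `PadicLayerTransport` §0–§1 with `layer p m` replaced by `F` (same proofs). [adapted from
`Summits/BirchSwinnertonDyer/Rank1Residual/Additive/PadicLayerTransport.lean`]

HONEST FRAMING: definitions and definitional lemmas only; closes no item; BSD is not proved by any of this.

References: [Kobayashi2003] §8.4 (the fields `k_n`); [SilvermanAEC2009] VII.2.2 (points over subfields / base change).
-/

set_option autoImplicit false
-- the Theorems namespace of this sub repeats the summit name by design (D-0017 nested layout)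
set_option linter.dupNamespace false

noncomputable section

open scoped Classical Topology NNReal

namespace Summit.BirchSwinnertonDyer.BirchSwinnertonDyer.Theorems.SignedEC

open Summit.BirchSwinnertonDyer.Rank1Residual.Additive Summit.BirchSwinnertonDyer.Rank1Residual.Additive.BallEval
open WeierstrassCurve Literature.NumberTheory.EllipticCurves Literature.NumberTheory.EllipticCurves.FormalGroupChart

/-- **A subfield `F ⊂ Ω = ℚ̄_p` as a type** (a synonym of `↥F` carrying only the normed-field structure, so that its points use the
classical decidable equality of the generic complete-field theory; `PadicLayerTransport.LayerField` is the case `F = layer p m`).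
[cite: Kobayashi2003, §8.4] -/
def OmegaSubfield (p : ℕ) [Fact p.Prime] (F : IntermediateField ℚ_[p] (PadicAlgCl p)) : Type := ↥F

namespace OmegaSubfield

variable (p : ℕ) [hp : Fact p.Prime] (F : IntermediateField ℚ_[p] (PadicAlgCl p))

/-- The normed field structure of `F` (induced from `Ω`). [folklore] -/
instance instNontriviallyNormedField : NontriviallyNormedField (OmegaSubfield p F) :=
  inferInstanceAs (NontriviallyNormedField ↥F)

/-- `F` is a normed `ℚ_p`-algebra. [folklore] -/
instance instNormedAlgebra : NormedAlgebra ℚ_[p] (OmegaSubfield p F) :=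
  inferInstanceAs (NormedAlgebra ℚ_[p] ↥F)

/-- `F` is ultrametric. [folklore] -/
instance instIsUltrametricDist : IsUltrametricDist (OmegaSubfield p F) :=
  inferInstanceAs (IsUltrametricDist ↥F)

/-- `F` is complete when finite over `ℚ_p`. [folklore] -/
instance instCompleteSpace [FiniteDimensional ℚ_[p] ↥F] : CompleteSpace (OmegaSubfield p F) :=
  (FiniteDimensional.complete ℚ_[p] ↥F : CompleteSpace ↥F)

/-- The inclusion `F → Ω` as a `ℚ_p`-algebra map. [folklore] -/
def emb : OmegaSubfield p F →ₐ[ℚ_[p]] PadicAlgCl p := IntermediateField.val F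

/-- An element of `Ω` lying in `F`, as an element of the type `OmegaSubfield p F`. [folklore] -/
def mk (x : PadicAlgCl p) (hx : x ∈ F) : OmegaSubfield p F := (⟨x, hx⟩ : ↥F)

variable {p F}

/-- `emb (mk x) = x`. [folklore] -/
@[simp] theorem emb_mk (x : PadicAlgCl p) (hx : x ∈ F) : emb p F (mk p F x hx) = x := rfl

/-- `emb x ∈ F`. [folklore] -/
theorem emb_mem (x : OmegaSubfield p F) : emb p F x ∈ F := (show ↥F from x).2

/-- `mk (emb x) = x`. [folklore] -/
@[simp] theorem mk_emb (x : OmegaSubfield p F) : mk p F (emb p F x) (emb_mem x) = x := rfl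

/-- `‖emb x‖ = ‖x‖`. [folklore] -/
theorem norm_emb (x : OmegaSubfield p F) : ‖emb p F x‖ = ‖x‖ := rfl

/-- `emb` is injective. [folklore] -/
theorem emb_injective : Function.Injective (emb p F) := (IntermediateField.val F).toRingHom.injective

/-- `emb` is continuous. [folklore] -/
theorem continuous_emb : Continuous (emb p F) := continuous_subtype_val

variable (p F) (M : WeierstrassCurve ℤ_[p])

/-- **The embedding of `F`-points into `Ω`-points** (Mathlib `Point.map` of the inclusion; `PadicLayerTransport.toOmega` is the case
`F = layer p m`). [cite: SilvermanAEC2009, VII.2.2] -/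
def toOmega : (curveK p (OmegaSubfield p F) M).toAffine.Point →+ (genFibΩ p M).toAffine.Point :=
  Affine.Point.map (W' := M.map (PadicInt.Coe.ringHom (p := p))) (emb p F)

variable {p F M}

/-- Nonsingularity transfers along the inclusion `F ⊂ Ω`. [folklore] -/
theorem nonsingular_emb {x y : OmegaSubfield p F} (h : (curveK p (OmegaSubfield p F) M).toAffine.Nonsingular x y) :
    (genFibΩ p M).toAffine.Nonsingular (emb p F x) (emb p F y) :=
  (Affine.baseChange_nonsingular (W := (M.map (PadicInt.Coe.ringHom (p := p))).toAffine)
    (f := emb p F) emb_injective x y).mpr h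

/-- Nonsingularity descends along the inclusion `F ⊂ Ω`. [folklore] -/
theorem nonsingular_mk {x y : PadicAlgCl p} (hx : x ∈ F) (hy : y ∈ F) (h : (genFibΩ p M).toAffine.Nonsingular x y) :
    (curveK p (OmegaSubfield p F) M).toAffine.Nonsingular (mk p F x hx) (mk p F y hy) :=
  (Affine.baseChange_nonsingular (W := (M.map (PadicInt.Coe.ringHom (p := p))).toAffine)
    (f := emb p F) emb_injective (mk p F x hx) (mk p F y hy)).mp h

/-- `toOmega` on an affine point. [folklore] -/
theorem toOmega_some {x y : OmegaSubfield p F} (h : (curveK p (OmegaSubfield p F) M).toAffine.Nonsingular x y) :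
    toOmega p F M (.some x y h) = .some (emb p F x) (emb p F y) (nonsingular_emb h) := rfl

/-- `toOmega 0 = 0`. [folklore] -/
theorem toOmega_zero' : toOmega p F M 0 = 0 := rfl

/-- `toOmega` is injective. [folklore] -/
theorem toOmega_injective : Function.Injective (toOmega p F M) :=
  Affine.Point.map_injective (W' := M.map (PadicInt.Coe.ringHom (p := p))) _

end OmegaSubfield

end Summit.BirchSwinnertonDyer.BirchSwinnertonDyer.Theorems.SignedEC

end
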